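import Mathlib
import HarnessLib
import Literature.AlgebraicGeometry.Resolution.RegularLocalRingsProofs
import Literature.AlgebraicGeometry.Resolution.AdicCompletionRegular
import Literature.NumberTheory.EllipticCurves.NeronModelCodimOne
import Summits.ResolutionOfSingularities.ResolutionOfSingularities.Theorems.WildQuotientsWildQuotientResolutionKSGoingDownSpecTools

/-!
# Kollár–Szabó going down, local algebra of the exceptional prime: `(t) ⊂ 𝒪_{X̃,x₁}` is a height-one
# prime with discrete-valuation-ring localisation and regular quotient of dimension `dim - 1`
# (crux `WildQuotients.WildQuotientResolution`, stub `stub_phaseZeroHighDim`)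

Crux stmt-ResolutionOfSingularities-15640 (`WildQuotientResolution`), registered stub `stub_phaseZeroHighDim`;
programme: discharge `Literature.AlgebraicGeometry.GroupActions.KollarSzaboGoingDown` via
✓`kollarSzaboGoingDown_of_step` (p828172), whose hypothesis `hstep` asks, at the `H`-fixed point `x₁` of the
point blow-up (hand 8-g1, (K2): the quadratic transform `S₁ = S[𝔪/t]_𝔫`, regular local of dimension
`dim S = n + 1`, with `t ∈ 𝔫 ∖ 𝔫²` the exceptional parameter), for
(η) a point `η` whose local ring is a VALUATION RING and (E) an integral `E ∋ x₁` through `η` with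
`𝒪_{E,x₁}` regular of dimension `n`. Both come from the EXCEPTIONAL PRIME `𝔮 = (t)`:

* `isPrime_span_singleton_of_not_mem_sq` — in a regular local ring `S₁`, for `t ∈ 𝔪 ∖ 𝔪²` the ideal
  `(t)` is prime (`S₁/(t)` is regular — Matsumura 14.2, tree `quotient_span_singleton` — hence a domain,
  tree `isDomain_of_isRegularLocalRing`);
* `height_span_singleton_of_not_mem_sq` — `ht (t) = 1` (Krull);
* `isDiscreteValuationRing_localization_span_singleton` / `valuationRing_localization_span_singleton` —
  `(S₁)_{(t)}` is a discrete valuation ring (a regular local ring of dimension `1`; Serre's localisation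
  theorem is the tree's `isRegularRing_of_isRegularLocalRing`): the local ring of `X̃` at the generic
  point `η` of the exceptional divisor through `x₁`;
* `ringKrullDim_quotient_span_singleton_eq` — `dim S₁/(t) = n` when `dim S₁ = n + 1`: the local ring
  `𝒪_{E,x₁}` of the exceptional divisor `E = V(t)`, regular (`isRegularLocalRing_quotient_span_singleton`);
* `valuationRing_localization_comap_span_singleton` — the same for a prime `𝔫` of a Noetherian domain
  `T` (the chart ring `S[𝔪/t]`) with `T_𝔫` regular: the contraction `𝔮 = (t)T_𝔫 ∩ T` is a prime of `T`
  inside `𝔫` containing `t`, and `T_𝔮` is a valuation ring.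

[OURS · crux stmt-ResolutionOfSingularities-15640 · helper toward `stub_phaseZeroHighDim` ((K4') local algebra
for `hstep`; NOT a proof of the stub); counted 0; AI-level work, weaker than expert review.] [folklore;
cite: Matsumura1987, Thm. 14.2]
-/

-- single-problem summit: the doubled namespace component `ResolutionOfSingularities` is forced
set_option linter.dupNamespace false

noncomputable section

open IsLocalRing
open Literature.AlgebraicGeometry.Resolution

namespace Summit.ResolutionOfSingularities.ResolutionOfSingularities.Theorems.WildQuotientResolution.KSGoingDown

universe u

section RegularLocal

variable {S : Type u} [CommRing S] [IsRegularLocalRing S] {t : S}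

-- `IsDomain S` holds for every regular local ring (tree `isDomain_of_isRegularLocalRing`); it is taken
-- as an instance argument where the statements need it to be inferred.

/-- In a regular local ring, an element of `𝔪 ∖ 𝔪²` generates a PRIME ideal (`S/(t)` is a regular local
ring, hence a domain). [cite: Matsumura1987, Thm. 14.2] -/
theorem isPrime_span_singleton_of_not_mem_sq (ht : t ∈ maximalIdeal S)
    (ht2 : t ∉ (maximalIdeal S) ^ 2) : (Ideal.span {t}).IsPrime := by
  obtain ⟨hreg, -⟩ := quotient_span_singleton S ht ht2
  haveI := hreg
  haveI : IsDomain (S ⧸ Ideal.span {t}) := isDomain_of_isRegularLocalRing _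
  exact (Ideal.Quotient.isDomain_iff_prime _).mp inferInstance

/-- `t ∈ 𝔪 ∖ 𝔪²` is non-zero. [folklore] -/
theorem ne_zero_of_not_mem_sq (ht2 : t ∉ (maximalIdeal S) ^ 2) : t ≠ 0 := by
  rintro rfl
  exact ht2 (Ideal.zero_mem _)

/-- In a regular local ring, for `t ∈ 𝔪 ∖ 𝔪²` the prime `(t)` has height one (Krull). [folklore] -/
theorem height_span_singleton_of_not_mem_sq (ht : t ∈ maximalIdeal S)
    (ht2 : t ∉ (maximalIdeal S) ^ 2) : (Ideal.span {t}).height = 1 := by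
  haveI : IsDomain S := isDomain_of_isRegularLocalRing S
  refine Ideal.height_span_singleton_eq_one_of_mem_nonZeroDivisors
    (mem_nonZeroDivisors_of_ne_zero (ne_zero_of_not_mem_sq ht2)) ?_
  exact fun hu => (IsLocalRing.mem_maximalIdeal _).mp ht hu

/-- **`S_{(t)}` is a discrete valuation ring** for `S` regular local and `t ∈ 𝔪 ∖ 𝔪²`: a localisation of
a regular local ring is regular (Serre; tree `isRegularRing_of_isRegularLocalRing`), of dimension
`ht (t) = 1`. This is the local ring of the blow-up at the generic point of the exceptional divisor.
[cite: Matsumura1987, Thm. 19.3] -/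
theorem isDiscreteValuationRing_localization_span_singleton [IsDomain S] (ht : t ∈ maximalIdeal S)
    (ht2 : t ∉ (maximalIdeal S) ^ 2) [hp : (Ideal.span {t}).IsPrime] :
    IsDiscreteValuationRing (Localization.AtPrime (Ideal.span {t})) := by
  haveI : IsRegularRing S := isRegularRing_of_isRegularLocalRing S
  haveI : IsRegularLocalRing (Localization.AtPrime (Ideal.span {t})) := inferInstance
  have hdim : ringKrullDim (Localization.AtPrime (Ideal.span {t})) = 1 := by
    rw [IsLocalization.AtPrime.ringKrullDim_eq_height (Ideal.span {t}),
      height_span_singleton_of_not_mem_sq ht ht2]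
    rfl
  exact Literature.NumberTheory.EllipticCurves.isDiscreteValuationRing_of_isRegularLocalRing _ hdim

/-- `S_{(t)}` is a valuation ring (for `S` regular local, `t ∈ 𝔪 ∖ 𝔪²`). [folklore] -/
theorem valuationRing_localization_span_singleton [IsDomain S] (ht : t ∈ maximalIdeal S)
    (ht2 : t ∉ (maximalIdeal S) ^ 2) [hp : (Ideal.span {t}).IsPrime] :
    ValuationRing (Localization.AtPrime (Ideal.span {t})) := by
  haveI := isDiscreteValuationRing_localization_span_singleton ht ht2
  infer_instance

/-- **`S/(t)` is a regular local ring** for `S` regular local and `t ∈ 𝔪 ∖ 𝔪²` (Matsumura 14.2; the local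
ring of the exceptional divisor at `x₁`). [cite: Matsumura1987, Thm. 14.2] -/
theorem isRegularLocalRing_quotient_span_singleton (ht : t ∈ maximalIdeal S)
    (ht2 : t ∉ (maximalIdeal S) ^ 2) : IsRegularLocalRing (S ⧸ Ideal.span {t}) :=
  (quotient_span_singleton S ht ht2).1

/-- **`dim S/(t) = n` when `dim S = n + 1`** (for `t ∈ 𝔪 ∖ 𝔪²`). [cite: Matsumura1987, Thm. 14.2] -/
theorem ringKrullDim_quotient_span_singleton_eq (ht : t ∈ maximalIdeal S)
    (ht2 : t ∉ (maximalIdeal S) ^ 2) {n : ℕ} (hn : ringKrullDim S = (n + 1 : ℕ)) :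
    ringKrullDim (S ⧸ Ideal.span {t}) = n := by
  obtain ⟨hreg, hdim⟩ := quotient_span_singleton S ht ht2
  haveI := hreg
  obtain ⟨m, hm⟩ := ringKrullDim_eq_nat (S ⧸ Ideal.span {t})
  rw [hm, hn] at hdim
  have : m + 1 = n + 1 := by exact_mod_cast hdim
  rw [hm]
  exact_mod_cast Nat.add_right_cancel this


/-- **`S_{(t)}` is a discrete valuation ring whenever `(t)` is a non-zero prime of the regular local `S`** (no hypothesis
`t ∉ 𝔪²`: `(t)` has height one by Krull and `S_{(t)}` is regular by Serre's localisation theorem). For the quadratic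
transform `R₁`: `(t)R₁` is prime because `R₁/(t)` is regular (✓`isRegularLocalRing_ofPrime_blowupRing_quotient`).
[cite: Matsumura1987, Thm. 19.3] -/
theorem isDiscreteValuationRing_localization_of_isPrime_span_singleton [IsDomain S] (ht : t ∈ maximalIdeal S)
    (ht0 : t ≠ 0) [hp : (Ideal.span {t}).IsPrime] :
    IsDiscreteValuationRing (Localization.AtPrime (Ideal.span {t})) := by
  haveI : IsRegularRing S := isRegularRing_of_isRegularLocalRing S
  have hht : (Ideal.span {t}).height = 1 :=
    Ideal.height_span_singleton_eq_one_of_mem_nonZeroDivisors (mem_nonZeroDivisors_of_ne_zero ht0)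
      fun hu => (IsLocalRing.mem_maximalIdeal _).mp ht hu
  have hdim : ringKrullDim (Localization.AtPrime (Ideal.span {t})) = 1 := by
    rw [IsLocalization.AtPrime.ringKrullDim_eq_height (Ideal.span {t}), hht]
    rfl
  exact Literature.NumberTheory.EllipticCurves.isDiscreteValuationRing_of_isRegularLocalRing _ hdim

/-- `S_{(t)}` is a valuation ring whenever `(t)` is a non-zero prime of the regular local `S`. [folklore] -/
theorem valuationRing_localization_of_isPrime_span_singleton [IsDomain S] (ht : t ∈ maximalIdeal S)
    (ht0 : t ≠ 0) [hp : (Ideal.span {t}).IsPrime] :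
    ValuationRing (Localization.AtPrime (Ideal.span {t})) := by
  haveI := isDiscreteValuationRing_localization_of_isPrime_span_singleton ht ht0
  infer_instance

omit [IsRegularLocalRing S] in
/-- A principal ideal whose quotient is a domain (e.g. a regular local ring) is prime. [folklore] -/
theorem isPrime_span_singleton_of_isDomain_quotient (t : S) [IsDomain (S ⧸ Ideal.span {t})] :
    (Ideal.span {t}).IsPrime :=
  (Ideal.Quotient.isDomain_iff_prime _).mp inferInstance

end RegularLocal

/-! ## The contracted exceptional prime of a chart ring -/

section Chart

variable {T : Type u} [CommRing T] [IsDomain T] (𝔫 : Ideal T) [𝔫.IsPrime]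
  [IsRegularLocalRing (Localization.AtPrime 𝔫)] (t : T)

/-- **The exceptional prime of a chart.** Let `T` be a domain (e.g. the chart ring `S[𝔪/t]` of a point
blow-up), `𝔫` a prime with `T_𝔫` regular, and `t ∈ T` with `t ∈ 𝔫T_𝔫 ∖ (𝔫T_𝔫)²`. Then the contraction
`𝔮 = (t)T_𝔫 ∩ T` is a prime ideal of `T`, contained in `𝔫` and containing `t`, whose local ring `T_𝔮` is
a valuation ring (indeed `T_𝔮 ≅ (T_𝔫)_{(t)}` is a discrete valuation ring). In the blow-up: `𝔮` is the
generic point of the exceptional divisor through the point `𝔫`. [folklore] -/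
theorem valuationRing_localization_comap_span_singleton
    (ht : algebraMap T (Localization.AtPrime 𝔫) t ∈ maximalIdeal (Localization.AtPrime 𝔫))
    (ht2 : algebraMap T (Localization.AtPrime 𝔫) t ∉ (maximalIdeal (Localization.AtPrime 𝔫)) ^ 2) :
    ∃ (𝔮 : Ideal T) (_ : 𝔮.IsPrime), 𝔮 ≤ 𝔫 ∧ t ∈ 𝔮 ∧
      𝔮 = (Ideal.span {algebraMap T (Localization.AtPrime 𝔫) t}).comap
        (algebraMap T (Localization.AtPrime 𝔫)) ∧
      ValuationRing (Localization.AtPrime 𝔮) := by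
  set t' := algebraMap T (Localization.AtPrime 𝔫) t with ht'
  haveI hp : (Ideal.span {t'}).IsPrime := isPrime_span_singleton_of_not_mem_sq ht ht2
  let 𝔮 : Ideal T := (Ideal.span {t'}).comap (algebraMap T (Localization.AtPrime 𝔫))
  haveI h𝔮 : 𝔮.IsPrime := Ideal.IsPrime.comap _
  refine ⟨𝔮, h𝔮, ?_, ?_, rfl, ?_⟩
  · -- `𝔮 ≤ 𝔫`: `(t') ≤ 𝔪_{T_𝔫}` and `𝔪_{T_𝔫} ∩ T = 𝔫`
    intro z hz
    have hz' : algebraMap T (Localization.AtPrime 𝔫) z ∈ maximalIdeal (Localization.AtPrime 𝔫) := by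
      have hle : Ideal.span {t'} ≤ maximalIdeal _ := (Ideal.span_singleton_le_iff_mem _).mpr ht
      exact hle hz
    by_contra hzn
    exact (IsLocalRing.mem_maximalIdeal _).mp hz'
      (IsLocalization.map_units (Localization.AtPrime 𝔫) (⟨z, hzn⟩ : 𝔫.primeCompl))
  · exact Ideal.mem_comap.mpr (Ideal.subset_span rfl)
  · -- `T_𝔮 ≅ (T_𝔫)_{(t')}` is a (discrete) valuation ring
    haveI : IsDomain (Localization.AtPrime 𝔫) := IsLocalization.isDomain_of_local_atPrime ‹_›
    haveI := valuationRing_localization_span_singleton ht ht2 (hp := hp)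
    let e : Localization.AtPrime 𝔮 ≃ₐ[T] Localization.AtPrime (Ideal.span {t'}) :=
      IsLocalization.localizationLocalizationAtPrimeIsoLocalization 𝔫.primeCompl (Ideal.span {t'})
    exact valuationRing_of_ringEquiv e.symm.toRingEquiv

end Chart

end Summit.ResolutionOfSingularities.ResolutionOfSingularities.Theorems.WildQuotientResolution.KSGoingDown

end
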